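import Mathlib.Tactic.NoncommRing
import Mathlib.Tactic.Ring
import Mathlib.Algebra.CharZero.Defs
import Mathlib.Algebra.Field.Defs

/-!
# Venture HSemireg — fibre test (W³): ONE ANTICOMMUTING DIRECTION SUFFICES, AT EVERY AMPLITUDE

HONEST FRAMING. Kernel leaf for the computation cell `pub-hsemireg`, (W³) lane (theory seat th-3
gen 45;
file of record `run/shared/lean/pub/pub-hsemireg/theory/TH3-ANTICOMMUTING-DIRECTION.md`, legs
`theory/th3/g45/`). Same model, same statement shape and same reading as the tree leaf
`FibreTestW3AnticommutingPencilCriterion` (t-5 gen 26): an arbitrary ring `R` (read `R = End_k(M)`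
for a
graded `M = ⊕ₚ Mₚ`), odd pencil letters `u 0, u 1, u 2`, odd potentials `V k j` of three classes
`k = 0, 1, 2`, the Killing relations (E1) `{u l, V k j} + {u j, V k l} = 0`, `{u l, V k l} = 0`, the
cocycle relation (E2) `Σ_l [u l, B^k_l] = 0` with `B^k_i = u_{i-1} V k_{i+1} + V k_{i+1} u_{i-1}`
(indices mod 3), the alternating cubic `T = Σ_σ sgn σ · B⁰_{σ0} B¹_{σ1} B²_{σ2}` (path order) and an
additive `str : R →+ S` into a field of characteristic zero that is odd on `u 2`
(`str (u 2 * y) = -str (y * u 2)`; read: the supertrace — products of odd degree have supertrace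
zero, so the relation holds for every `y`). Nothing in this file constructs an object on an abelian
variety, proves the four-level conjecture (W³)₄, or bears on HC, HC_CM or HC_AV.

THE THEOREM. t-5 g26's criterion assumes that ALL THREE pairs of distinct pencil letters
anticommute.
Here ONE direction suffices: if `x := u 2` anticommutes with the other two letters,
`u 2 * u 0 + u 0 * u 2 = 0` and `u 2 * u 1 + u 1 * u 2 = 0` — nothing is assumed about `u 2 * u 2`,
`u 0 * u 1 + u 1 * u 0`, `u 0 * u 0`, `u 1 * u 1` —, then `str T = 0` for all (E1)∧(E2) classes.
Read
invariantly: (W³) holds at every amplitude as soon as SOME pencil member `u(s)` anticommutes with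
`u(t)` for all `t` in a plane complementary to `s`. This contains th-3 g28's flat-stratum theorem
(all
anticommutators vanish) and t-5 g26's anticommuting-pencil criterion.

THE PROOF (structured, no certificate; `supertrace_cubic_eq_zero_of_closed_components` is the
mechanism, `supertrace_cubic_eq_zero_of_anticommuting_direction` the cell-facing statement). Write
`δ y := x y ∓ y x` for the super-commutator with `x`. In the frame where `x = u 2`, two components
of
every class are `δ`-exact by (E1): `B^k_0 = {x, V k 1}` and `B^k_1 = {u 0, V k 2} = -{x, V k 0}`.
The
two vanishing anticommutators and (E1) give `[x, B^k_0] = [x, B^k_1] = 0` (super-Jacobi), and with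
(E2) `3 · [x, B^k_2] = 0`. Expanding `T` by the position of the index-`2` component, `T` equals
`x W + W x` for an explicit `W` plus words each containing one of `[x, B^k_i]`, `[x², V k 0]`,
`[x², V k 1]` (one `noncomm_ring` identity); `str (x W + W x) = 0`, the obstruction words vanish
(those with `[x, B^k_2]` after multiplication by `3`), and `S` has characteristic zero.
-/

namespace Summit.Ventures.HSemireg.W3AnticommutingDirectionCriterion

/-- MECHANISM (any ring `R`, any additive `str` into a field of characteristic zero that is odd on
`x`). Three «classes» `k = 0, 1, 2` with components `x * a k + a k * x`, `-(x * b k + b k * x)`, `q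
k`;
if `x` commutes with `x * a k + a k * x` and with `x * b k + b k * x`, and `3 · (x * q k - q k * x)
= 0`,
then the alternating cubic of the three classes has `str = 0`: the cubic equals `x * W + W * x` plus
explicit obstruction words (`key`, one `noncomm_ring` identity). -/
theorem supertrace_cubic_eq_zero_of_closed_components {R S : Type*} [Ring R] [Field S] [CharZero S]
    (str : R →+ S) (x : R) (a b q : Fin 3 → R)
    (hodd : ∀ y : R, str (x * y) = -str (y * x))
    (hra : ∀ k : Fin 3, (x * (x * a k + a k * x) - (x * a k + a k * x) * x) = 0)
    (hrb : ∀ k : Fin 3, (x * (x * b k + b k * x) - (x * b k + b k * x) * x) = 0)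
    (hrq : ∀ k : Fin 3,
      (x * q k - q k * x) + (x * q k - q k * x) + (x * q k - q k * x) = 0) :
    str
      ((x * a 0 + a 0 * x) * (-(x * b 1 + b 1 * x)) * q 2 - (x * a 0 + a 0 * x) * q 1 * (-(x * b 2 +
      b 2 * x)) - (-(x * b 0 + b 0 * x)) * (x * a 1 + a 1 * x) * q 2 + (-(x * b 0 + b 0 * x)) * q 1
      * (x * a 2 + a 2 * x) + q 0 * (x * a 1 + a 1 * x) * (-(x * b 2 + b 2 * x)) - q 0 * (-(x * b 1
      + b 1 * x)) * (x * a 2 + a 2 * x)) = 0 := by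
  have key :
      ((x * a 0 + a 0 * x) * (-(x * b 1 + b 1 * x)) * q 2 - (x * a 0 + a 0 * x) * q 1 * (-(x * b 2 +
      b 2 * x)) - (-(x * b 0 + b 0 * x)) * (x * a 1 + a 1 * x) * q 2 + (-(x * b 0 + b 0 * x)) * q 1
      * (x * a 2 + a 2 * x) + q 0 * (x * a 1 + a 1 * x) * (-(x * b 2 + b 2 * x)) - q 0 * (-(x * b 1
      + b 1 * x)) * (x * a 2 + a 2 * x))
      = (x *
        (q 0 * (b 1 * (x * a 2 + a 2 * x) - a 1 * (x * b 2 + b 2 * x)) + (b 0 * (x * a 1 + a 1 * x)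
        - a 0 * (x * b 1 + b 1 * x)) * q 2 + a 0 * q 1 * (x * b 2 + b 2 * x) - b 0 * q 1 * (x * a 2
        + a 2 * x))
        +
        (q 0 * (b 1 * (x * a 2 + a 2 * x) - a 1 * (x * b 2 + b 2 * x)) + (b 0 * (x * a 1 + a 1 * x)
        - a 0 * (x * b 1 + b 1 * x)) * q 2 + a 0 * q 1 * (x * b 2 + b 2 * x) - b 0 * q 1 * (x * a 2
        + a 2 * x))
        * x) +
        (-((x * q 0 - q 0 * x) * (b 1 * (x * a 2 + a 2 * x) - a 1 * (x * b 2 + b 2 * x))) + q 0 * (b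
        1 * (x * (x * a 2 + a 2 * x) - (x * a 2 + a 2 * x) * x) - a 1 * (x * (x * b 2 + b 2 * x) -
        (x * b 2 + b 2 * x) * x)) + (b 0 * (x * a 1 + a 1 * x) - a 0 * (x * b 1 + b 1 * x)) * (x * q
        2 - q 2 * x) + (b 0 * (x * (x * a 1 + a 1 * x) - (x * a 1 + a 1 * x) * x) - a 0 * (x * (x *
        b 1 + b 1 * x) - (x * b 1 + b 1 * x) * x)) * q 2 + a 0 * (x * q 1 - q 1 * x) * (x * b 2 + b
        2 * x) + a 0 * q 1 * (x * (x * b 2 + b 2 * x) - (x * b 2 + b 2 * x) * x) - b 0 * (x * q 1 -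
        q 1 * x) * (x * a 2 + a 2 * x) - b 0 * q 1 * (x * (x * a 2 + a 2 * x) - (x * a 2 + a 2 * x)
        * x)) := by
    noncomm_ring
  have hδ : str (x *
        (q 0 * (b 1 * (x * a 2 + a 2 * x) - a 1 * (x * b 2 + b 2 * x)) + (b 0 * (x * a 1 + a 1 * x)
        - a 0 * (x * b 1 + b 1 * x)) * q 2 + a 0 * q 1 * (x * b 2 + b 2 * x) - b 0 * q 1 * (x * a 2
        + a 2 * x))
        +
        (q 0 * (b 1 * (x * a 2 + a 2 * x) - a 1 * (x * b 2 + b 2 * x)) + (b 0 * (x * a 1 + a 1 * x)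
        - a 0 * (x * b 1 + b 1 * x)) * q 2 + a 0 * q 1 * (x * b 2 + b 2 * x) - b 0 * q 1 * (x * a 2
        + a 2 * x))
        * x) = 0 := by
    rw [map_add, hodd, neg_add_cancel]
  have h3 :
        (-((x * q 0 - q 0 * x) * (b 1 * (x * a 2 + a 2 * x) - a 1 * (x * b 2 + b 2 * x))) + q 0 * (b
        1 * (x * (x * a 2 + a 2 * x) - (x * a 2 + a 2 * x) * x) - a 1 * (x * (x * b 2 + b 2 * x) -
        (x * b 2 + b 2 * x) * x)) + (b 0 * (x * a 1 + a 1 * x) - a 0 * (x * b 1 + b 1 * x)) * (x * q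
        2 - q 2 * x) + (b 0 * (x * (x * a 1 + a 1 * x) - (x * a 1 + a 1 * x) * x) - a 0 * (x * (x *
        b 1 + b 1 * x) - (x * b 1 + b 1 * x) * x)) * q 2 + a 0 * (x * q 1 - q 1 * x) * (x * b 2 + b
        2 * x) + a 0 * q 1 * (x * (x * b 2 + b 2 * x) - (x * b 2 + b 2 * x) * x) - b 0 * (x * q 1 -
        q 1 * x) * (x * a 2 + a 2 * x) - b 0 * q 1 * (x * (x * a 2 + a 2 * x) - (x * a 2 + a 2 * x)
        * x))
        +
        (-((x * q 0 - q 0 * x) * (b 1 * (x * a 2 + a 2 * x) - a 1 * (x * b 2 + b 2 * x))) + q 0 * (b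
        1 * (x * (x * a 2 + a 2 * x) - (x * a 2 + a 2 * x) * x) - a 1 * (x * (x * b 2 + b 2 * x) -
        (x * b 2 + b 2 * x) * x)) + (b 0 * (x * a 1 + a 1 * x) - a 0 * (x * b 1 + b 1 * x)) * (x * q
        2 - q 2 * x) + (b 0 * (x * (x * a 1 + a 1 * x) - (x * a 1 + a 1 * x) * x) - a 0 * (x * (x *
        b 1 + b 1 * x) - (x * b 1 + b 1 * x) * x)) * q 2 + a 0 * (x * q 1 - q 1 * x) * (x * b 2 + b
        2 * x) + a 0 * q 1 * (x * (x * b 2 + b 2 * x) - (x * b 2 + b 2 * x) * x) - b 0 * (x * q 1 -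
        q 1 * x) * (x * a 2 + a 2 * x) - b 0 * q 1 * (x * (x * a 2 + a 2 * x) - (x * a 2 + a 2 * x)
        * x))
        +
        (-((x * q 0 - q 0 * x) * (b 1 * (x * a 2 + a 2 * x) - a 1 * (x * b 2 + b 2 * x))) + q 0 * (b
        1 * (x * (x * a 2 + a 2 * x) - (x * a 2 + a 2 * x) * x) - a 1 * (x * (x * b 2 + b 2 * x) -
        (x * b 2 + b 2 * x) * x)) + (b 0 * (x * a 1 + a 1 * x) - a 0 * (x * b 1 + b 1 * x)) * (x * q
        2 - q 2 * x) + (b 0 * (x * (x * a 1 + a 1 * x) - (x * a 1 + a 1 * x) * x) - a 0 * (x * (x *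
        b 1 + b 1 * x) - (x * b 1 + b 1 * x) * x)) * q 2 + a 0 * (x * q 1 - q 1 * x) * (x * b 2 + b
        2 * x) + a 0 * q 1 * (x * (x * b 2 + b 2 * x) - (x * b 2 + b 2 * x) * x) - b 0 * (x * q 1 -
        q 1 * x) * (x * a 2 + a 2 * x) - b 0 * q 1 * (x * (x * a 2 + a 2 * x) - (x * a 2 + a 2 * x)
        * x))
      =
        (-(((x * q 0 - q 0 * x) + (x * q 0 - q 0 * x) + (x * q 0 - q 0 * x)) * (b 1 * (x * a 2 + a 2
        * x) - a 1 * (x * b 2 + b 2 * x))) + q 0 * (b 1 * ((x * (x * a 2 + a 2 * x) - (x * a 2 + a 2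
        * x) * x) + (x * (x * a 2 + a 2 * x) - (x * a 2 + a 2 * x) * x) + (x * (x * a 2 + a 2 * x) -
        (x * a 2 + a 2 * x) * x)) - a 1 * ((x * (x * b 2 + b 2 * x) - (x * b 2 + b 2 * x) * x) + (x
        * (x * b 2 + b 2 * x) - (x * b 2 + b 2 * x) * x) + (x * (x * b 2 + b 2 * x) - (x * b 2 + b 2
        * x) * x))) + (b 0 * (x * a 1 + a 1 * x) - a 0 * (x * b 1 + b 1 * x)) * ((x * q 2 - q 2 * x)
        + (x * q 2 - q 2 * x) + (x * q 2 - q 2 * x)) + (b 0 * ((x * (x * a 1 + a 1 * x) - (x * a 1 +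
        a 1 * x) * x) + (x * (x * a 1 + a 1 * x) - (x * a 1 + a 1 * x) * x) + (x * (x * a 1 + a 1 *
        x) - (x * a 1 + a 1 * x) * x)) - a 0 * ((x * (x * b 1 + b 1 * x) - (x * b 1 + b 1 * x) * x)
        + (x * (x * b 1 + b 1 * x) - (x * b 1 + b 1 * x) * x) + (x * (x * b 1 + b 1 * x) - (x * b 1
        + b 1 * x) * x))) * q 2 + a 0 * ((x * q 1 - q 1 * x) + (x * q 1 - q 1 * x) + (x * q 1 - q 1
        * x)) * (x * b 2 + b 2 * x) + a 0 * q 1 * ((x * (x * b 2 + b 2 * x) - (x * b 2 + b 2 * x) *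
        x) + (x * (x * b 2 + b 2 * x) - (x * b 2 + b 2 * x) * x) + (x * (x * b 2 + b 2 * x) - (x * b
        2 + b 2 * x) * x)) - b 0 * ((x * q 1 - q 1 * x) + (x * q 1 - q 1 * x) + (x * q 1 - q 1 * x))
        * (x * a 2 + a 2 * x) - b 0 * q 1 * ((x * (x * a 2 + a 2 * x) - (x * a 2 + a 2 * x) * x) +
        (x * (x * a 2 + a 2 * x) - (x * a 2 + a 2 * x) * x) + (x * (x * a 2 + a 2 * x) - (x * a 2 +
        a 2 * x) * x))) := by
    noncomm_ring
  have hE3 :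
        (-((x * q 0 - q 0 * x) * (b 1 * (x * a 2 + a 2 * x) - a 1 * (x * b 2 + b 2 * x))) + q 0 * (b
        1 * (x * (x * a 2 + a 2 * x) - (x * a 2 + a 2 * x) * x) - a 1 * (x * (x * b 2 + b 2 * x) -
        (x * b 2 + b 2 * x) * x)) + (b 0 * (x * a 1 + a 1 * x) - a 0 * (x * b 1 + b 1 * x)) * (x * q
        2 - q 2 * x) + (b 0 * (x * (x * a 1 + a 1 * x) - (x * a 1 + a 1 * x) * x) - a 0 * (x * (x *
        b 1 + b 1 * x) - (x * b 1 + b 1 * x) * x)) * q 2 + a 0 * (x * q 1 - q 1 * x) * (x * b 2 + b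
        2 * x) + a 0 * q 1 * (x * (x * b 2 + b 2 * x) - (x * b 2 + b 2 * x) * x) - b 0 * (x * q 1 -
        q 1 * x) * (x * a 2 + a 2 * x) - b 0 * q 1 * (x * (x * a 2 + a 2 * x) - (x * a 2 + a 2 * x)
        * x))
        +
        (-((x * q 0 - q 0 * x) * (b 1 * (x * a 2 + a 2 * x) - a 1 * (x * b 2 + b 2 * x))) + q 0 * (b
        1 * (x * (x * a 2 + a 2 * x) - (x * a 2 + a 2 * x) * x) - a 1 * (x * (x * b 2 + b 2 * x) -
        (x * b 2 + b 2 * x) * x)) + (b 0 * (x * a 1 + a 1 * x) - a 0 * (x * b 1 + b 1 * x)) * (x * q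
        2 - q 2 * x) + (b 0 * (x * (x * a 1 + a 1 * x) - (x * a 1 + a 1 * x) * x) - a 0 * (x * (x *
        b 1 + b 1 * x) - (x * b 1 + b 1 * x) * x)) * q 2 + a 0 * (x * q 1 - q 1 * x) * (x * b 2 + b
        2 * x) + a 0 * q 1 * (x * (x * b 2 + b 2 * x) - (x * b 2 + b 2 * x) * x) - b 0 * (x * q 1 -
        q 1 * x) * (x * a 2 + a 2 * x) - b 0 * q 1 * (x * (x * a 2 + a 2 * x) - (x * a 2 + a 2 * x)
        * x))
        +
        (-((x * q 0 - q 0 * x) * (b 1 * (x * a 2 + a 2 * x) - a 1 * (x * b 2 + b 2 * x))) + q 0 * (b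
        1 * (x * (x * a 2 + a 2 * x) - (x * a 2 + a 2 * x) * x) - a 1 * (x * (x * b 2 + b 2 * x) -
        (x * b 2 + b 2 * x) * x)) + (b 0 * (x * a 1 + a 1 * x) - a 0 * (x * b 1 + b 1 * x)) * (x * q
        2 - q 2 * x) + (b 0 * (x * (x * a 1 + a 1 * x) - (x * a 1 + a 1 * x) * x) - a 0 * (x * (x *
        b 1 + b 1 * x) - (x * b 1 + b 1 * x) * x)) * q 2 + a 0 * (x * q 1 - q 1 * x) * (x * b 2 + b
        2 * x) + a 0 * q 1 * (x * (x * b 2 + b 2 * x) - (x * b 2 + b 2 * x) * x) - b 0 * (x * q 1 -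
        q 1 * x) * (x * a 2 + a 2 * x) - b 0 * q 1 * (x * (x * a 2 + a 2 * x) - (x * a 2 + a 2 * x)
        * x)) = 0 := by
    rw [h3, hrq 0, hrq 1, hrq 2, hra 1, hra 2, hrb 1, hrb 2]
    noncomm_ring
  have hE : str
      (-((x * q 0 - q 0 * x) * (b 1 * (x * a 2 + a 2 * x) - a 1 * (x * b 2 + b 2 * x))) + q 0 * (b 1
      * (x * (x * a 2 + a 2 * x) - (x * a 2 + a 2 * x) * x) - a 1 * (x * (x * b 2 + b 2 * x) - (x *
      b 2 + b 2 * x) * x)) + (b 0 * (x * a 1 + a 1 * x) - a 0 * (x * b 1 + b 1 * x)) * (x * q 2 - q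
      2 * x) + (b 0 * (x * (x * a 1 + a 1 * x) - (x * a 1 + a 1 * x) * x) - a 0 * (x * (x * b 1 + b
      1 * x) - (x * b 1 + b 1 * x) * x)) * q 2 + a 0 * (x * q 1 - q 1 * x) * (x * b 2 + b 2 * x) + a
      0 * q 1 * (x * (x * b 2 + b 2 * x) - (x * b 2 + b 2 * x) * x) - b 0 * (x * q 1 - q 1 * x) * (x
      * a 2 + a 2 * x) - b 0 * q 1 * (x * (x * a 2 + a 2 * x) - (x * a 2 + a 2 * x) * x)) = 0 := by
    have h := congrArg str hE3
    rw [map_add, map_add, map_zero] at h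
    have h' : (3 : S) * str
        (-((x * q 0 - q 0 * x) * (b 1 * (x * a 2 + a 2 * x) - a 1 * (x * b 2 + b 2 * x))) + q 0 * (b
        1 * (x * (x * a 2 + a 2 * x) - (x * a 2 + a 2 * x) * x) - a 1 * (x * (x * b 2 + b 2 * x) -
        (x * b 2 + b 2 * x) * x)) + (b 0 * (x * a 1 + a 1 * x) - a 0 * (x * b 1 + b 1 * x)) * (x * q
        2 - q 2 * x) + (b 0 * (x * (x * a 1 + a 1 * x) - (x * a 1 + a 1 * x) * x) - a 0 * (x * (x *
        b 1 + b 1 * x) - (x * b 1 + b 1 * x) * x)) * q 2 + a 0 * (x * q 1 - q 1 * x) * (x * b 2 + b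
        2 * x) + a 0 * q 1 * (x * (x * b 2 + b 2 * x) - (x * b 2 + b 2 * x) * x) - b 0 * (x * q 1 -
        q 1 * x) * (x * a 2 + a 2 * x) - b 0 * q 1 * (x * (x * a 2 + a 2 * x) - (x * a 2 + a 2 * x)
        * x)) = 0 := by
      rw [← h]; ring
    exact (mul_eq_zero.mp h').resolve_left (by norm_num)
  rw [key, map_add, hδ, hE, add_zero]

/-- ONE ANTICOMMUTING DIRECTION SUFFICES FOR (W³), AT EVERY AMPLITUDE (th-3 g45). Same hypotheses as
`W3AnticommutingPencilCriterion.supertrace_cubic_eq_zero_of_anticommuting` except that only the two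
anticommutators through the direction `u 2` are assumed to vanish (`hK0`, `hK1`), and the oddness of
`str` is needed on `u 2` only. -/
theorem supertrace_cubic_eq_zero_of_anticommuting_direction {R S : Type*} [Ring R] [Field S]
    [CharZero S] (str : R →+ S) (u : Fin 3 → R) (V : Fin 3 → Fin 3 → R)
    (hodd : ∀ y : R, str (u 2 * y) = -str (y * u 2))
    (hE1d : ∀ k l : Fin 3, u l * V k l + V k l * u l = 0)
    (hE1 : ∀ k l j : Fin 3, u l * V k j + V k j * u l + u j * V k l + V k l * u j = 0)
    (hE2 : ∀ k : Fin 3, ((u 0 * (u 2 * V k 1 + V k 1 * u 2) - (u 2 * V k 1 + V k 1 * u 2) * u 0) +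
      (u 1 * (u 0 * V k 2 + V k 2 * u 0) - (u 0 * V k 2 + V k 2 * u 0) * u 1) + (u 2 * (u 1 * V k 0
      + V k 0 * u 1) - (u 1 * V k 0 + V k 0 * u 1) * u 2)) = 0)
    (hK0 : u 2 * u 0 + u 0 * u 2 = 0) (hK1 : u 2 * u 1 + u 1 * u 2 = 0) :
    str
      ((u 2 * V 0 1 + V 0 1 * u 2) * (u 0 * V 1 2 + V 1 2 * u 0) * (u 1 * V 2 0 + V 2 0 * u 1) - (u
      2 * V 0 1 + V 0 1 * u 2) * (u 1 * V 1 0 + V 1 0 * u 1) * (u 0 * V 2 2 + V 2 2 * u 0) - (u 0 *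
      V 0 2 + V 0 2 * u 0) * (u 2 * V 1 1 + V 1 1 * u 2) * (u 1 * V 2 0 + V 2 0 * u 1) + (u 0 * V 0
      2 + V 0 2 * u 0) * (u 1 * V 1 0 + V 1 0 * u 1) * (u 2 * V 2 1 + V 2 1 * u 2) + (u 1 * V 0 0 +
      V 0 0 * u 1) * (u 2 * V 1 1 + V 1 1 * u 2) * (u 0 * V 2 2 + V 2 2 * u 0) - (u 1 * V 0 0 + V 0
      0 * u 1) * (u 0 * V 1 2 + V 1 2 * u 0) * (u 2 * V 2 1 + V 2 1 * u 2)) = 0 := by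
  -- (E1): the index-1 component is minus the x-anticommutator of the potential V k 0
  have e : ∀ k : Fin 3, u 0 * V k 2 + V k 2 * u 0 = -(u 2 * V k 0 + V k 0 * u 2) := by
    intro k
    have h := hE1 k 2 0
    rw [add_assoc] at h
    exact eq_neg_of_add_eq_zero_right h
  -- [x, B^k_0] = 0 via (E1) B^k_0 = -(u 1-anticommutator of V k 2), super-Jacobi, hK1
  have hra : ∀ k : Fin 3,
      u 2 * (u 2 * V k 1 + V k 1 * u 2) - (u 2 * V k 1 + V k 1 * u 2) * u 2 = 0 := by
    intro k
    have h1 := hE1 k 2 1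
    have h2 := hE1d k 2
    calc u 2 * (u 2 * V k 1 + V k 1 * u 2) - (u 2 * V k 1 + V k 1 * u 2) * u 2
        = (u 2 * (u 2 * V k 1 + V k 1 * u 2 + u 1 * V k 2 + V k 2 * u 1)
            - (u 2 * V k 1 + V k 1 * u 2 + u 1 * V k 2 + V k 2 * u 1) * u 2)
          - ((u 2 * u 1 + u 1 * u 2) * V k 2 - V k 2 * (u 2 * u 1 + u 1 * u 2))
          + (u 1 * (u 2 * V k 2 + V k 2 * u 2) - (u 2 * V k 2 + V k 2 * u 2) * u 1) := by
          noncomm_ring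
      _ = 0 := by rw [h1, h2, hK1]; noncomm_ring
  -- [x, B^k_1] = 0 via (E1) B^k_1 = u 0-anticommutator of V k 2, super-Jacobi, hK0
  have hrb : ∀ k : Fin 3,
      u 2 * (u 2 * V k 0 + V k 0 * u 2) - (u 2 * V k 0 + V k 0 * u 2) * u 2 = 0 := by
    intro k
    have h1 := hE1 k 2 0
    have h2 := hE1d k 2
    calc u 2 * (u 2 * V k 0 + V k 0 * u 2) - (u 2 * V k 0 + V k 0 * u 2) * u 2
        = (u 2 * (u 2 * V k 0 + V k 0 * u 2 + u 0 * V k 2 + V k 2 * u 0)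
            - (u 2 * V k 0 + V k 0 * u 2 + u 0 * V k 2 + V k 2 * u 0) * u 2)
          - ((u 2 * u 0 + u 0 * u 2) * V k 2 - V k 2 * (u 2 * u 0 + u 0 * u 2))
          + (u 0 * (u 2 * V k 2 + V k 2 * u 2) - (u 2 * V k 2 + V k 2 * u 2) * u 0) := by
          noncomm_ring
      _ = 0 := by rw [h1, h2, hK0]; noncomm_ring
  -- 3 [x, B^k_2] = (E2) + (E1) and anticommutator corrections
  have hrq : ∀ k : Fin 3,
      (u 2 * (u 1 * V k 0 + V k 0 * u 1) - (u 1 * V k 0 + V k 0 * u 1) * u 2)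
      + (u 2 * (u 1 * V k 0 + V k 0 * u 1) - (u 1 * V k 0 + V k 0 * u 1) * u 2)
      + (u 2 * (u 1 * V k 0 + V k 0 * u 1) - (u 1 * V k 0 + V k 0 * u 1) * u 2) = 0 := by
    intro k
    have h0 := hE2 k
    have h10 := hE1 k 1 0
    have h20 := hE1 k 2 0
    calc (u 2 * (u 1 * V k 0 + V k 0 * u 1) - (u 1 * V k 0 + V k 0 * u 1) * u 2)
          + (u 2 * (u 1 * V k 0 + V k 0 * u 1) - (u 1 * V k 0 + V k 0 * u 1) * u 2)
          + (u 2 * (u 1 * V k 0 + V k 0 * u 1) - (u 1 * V k 0 + V k 0 * u 1) * u 2)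
        = ((u 0 * (u 2 * V k 1 + V k 1 * u 2) - (u 2 * V k 1 + V k 1 * u 2) * u 0) +
            (u 1 * (u 0 * V k 2 + V k 2 * u 0) - (u 0 * V k 2 + V k 2 * u 0) * u 1) +
            (u 2 * (u 1 * V k 0 + V k 0 * u 1) - (u 1 * V k 0 + V k 0 * u 1) * u 2))
          + (u 2 * (u 1 * V k 0 + V k 0 * u 1 + u 0 * V k 1 + V k 1 * u 0)
              - (u 1 * V k 0 + V k 0 * u 1 + u 0 * V k 1 + V k 1 * u 0) * u 2)
          - ((u 2 * u 0 + u 0 * u 2) * V k 1 - V k 1 * (u 2 * u 0 + u 0 * u 2))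
          + ((u 2 * u 1 + u 1 * u 2) * V k 0 - V k 0 * (u 2 * u 1 + u 1 * u 2))
          - (u 1 * (u 2 * V k 0 + V k 0 * u 2 + u 0 * V k 2 + V k 2 * u 0)
              - (u 2 * V k 0 + V k 0 * u 2 + u 0 * V k 2 + V k 2 * u 0) * u 1) := by
          noncomm_ring
      _ = 0 := by rw [h0, h10, h20, hK0, hK1]; noncomm_ring
  rw [e 0, e 1, e 2]
  exact supertrace_cubic_eq_zero_of_closed_components str (u 2) (fun k => V k 1) (fun k => V k 0)
    (fun k => u 1 * V k 0 + V k 0 * u 1) hodd hra hrb hrq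

end Summit.Ventures.HSemireg.W3AnticommutingDirectionCriterion
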